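import Literature.AlgebraicGeometry.Motives.GrassmannianUniversalChartData
import Literature.AlgebraicGeometry.Motives.GrassmannianQuotientOfFreeModule
import Literature.AlgebraicGeometry.Modules.KernelOfEpiHasRank
import HarnessLib

/-!
# The universal subbundle of the Grassmannian has rank `n − k`

Let `M` be a free abelian group with basis `b : J → M`, `#J = n`, and `Gr = grassmannianScheme M k` the
Grassmannian scheme of rank-`k` quotients of `M` with its universal quotient
`π : 𝒪_{Gr}^{(J)} = 𝒪_{Gr} ⊗ M ↠ 𝒬` (★ `universalQuotientπ`, rank `k`, an epimorphism). The
**universal (tautological) subbundle** is `𝒮 := ker π`; we do not introduce a name for it and spell it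
`kernel (universalQuotientπ k M b)` throughout. This file puts BOTH ranks of the tautological exact
sequence
`0 → 𝒮 → 𝒪_{Gr} ⊗ M → 𝒬 → 0`
on record (Görtz–Wedhorn I (8.4); II (17.7), Thm. 17.46: "an exact sequence of finite locally free
`𝒪_X`-modules"):

* `hasRank_freeModule` — `𝒪_T^{(J)}` has rank `#J` (the global frame ★ `freeModuleFrame`);
* `hasRank_kernel_of_epi_freeModule` — the kernel of ANY rank-`k` quotient `𝒪_T^{(J)} ↠ Q` has rank
  `#J − k` (★ `hasRank_kernel_of_epi`), and `k ≤ #J` if `T` has a point;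
* `hasRank_kernel_universalQuotientπ` — **`𝒮` has rank `#J − k`**; it is finite locally free and
  affine-localizing, and `π` is onto on the sections over EVERY affine open of `Gr`
  (`app_universalQuotientπ_surjective`);
* `hasRank_kernel_map_pullback_universalQuotientπ` — the same for the pulled-back sequence
  `0 → f^*𝒮' → 𝒪_T ⊗ M → f^*𝒬 → 0` along any `f : T ⟶ Gr` (pull-back is a left adjoint, so `f^*π` is
  again an epimorphism, and ranks pull back, ★ `hasRank_pullback`).

Everything is proved; theorems only (no definitions, facts, instances, notation).

## References

* U. Görtz, T. Wedhorn, *Algebraic Geometry I*, 2nd ed. (2020), (8.4) (pp. 213–215). [GortzWedhorn2020]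
* U. Görtz, T. Wedhorn, *Algebraic Geometry II*, Springer Spektrum (2023), (17.7) and Thm. 17.46
  (pp. 22–23; held e-text pp. 60–61). [GortzWedhorn2023]
* The Stacks Project, Tags 05P2, 089R. [StacksProject]
-/

noncomputable section

-- Mathlib's `Scheme.Modules` section API is stated across semireducible wrappers (as in Mathlib's own files).
set_option backward.isDefEq.respectTransparency false

universe u

open CategoryTheory CategoryTheory.Limits Opposite TopologicalSpace AlgebraicGeometry
open Literature.AlgebraicGeometry.Motives

namespace Literature.AlgebraicGeometry.Modules

variable (T : Scheme.{u}) (J : Type u) [Fintype J]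

/-- **The free module `𝒪_T^{(J)}` has rank `#J`** (its global frame ★ `freeModuleFrame T J ⊤` at every
point). [cite: GortzWedhorn2020, (8.4) (pp. 213–215)] -/
theorem hasRank_freeModule : HasRank (freeModule T J) (Fintype.card J) :=
  FrameSystem.hasRank (E := freeModule T J)
    { U := fun _ => ⊤
      mem := fun _ => trivial
      I := fun _ => J
      rank := fun _ => Fintype.card J
      enum := fun _ => Fintype.equivFin J
      frame := fun _ => freeModuleFrame T J ⊤ } (Fintype.card J) fun _ => rfl

variable {T J}

/-- **The kernel of a rank-`k` quotient `φ : 𝒪_T^{(J)} ↠ Q` of the free module has rank `#J − k`.**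
[cite: GortzWedhorn2023, (17.7) and Thm. 17.46 (pp. 22–23)] [cite: StacksProject, Tag 05P2] -/
theorem hasRank_kernel_of_epi_freeModule {Q : T.Modules} (φ : freeModule T J ⟶ Q) [Epi φ] {k : ℕ}
    (hQ : HasRank Q k) : HasRank (kernel φ) (Fintype.card J - k) :=
  hasRank_kernel_of_epi φ (hasRank_freeModule T J) hQ

/-- A rank-`k` quotient of `𝒪_T^{(J)}` over a scheme with a point has `k ≤ #J`.
[cite: StacksProject, Tag 05P2] -/
theorem le_card_of_epi_freeModule {Q : T.Modules} (φ : freeModule T J ⟶ Q) [Epi φ] {k : ℕ}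
    (hQ : HasRank Q k) (t : T) : k ≤ Fintype.card J :=
  le_of_epi_of_hasRank φ (hasRank_freeModule T J) hQ t

end Literature.AlgebraicGeometry.Modules

namespace Literature.AlgebraicGeometry.Motives.Grassmannian

open Literature.AlgebraicGeometry.Modules

variable (k : ℕ) (M : Type u) [AddCommGroup M] {J : Type u} [Fintype J] (b : Module.Basis J ℤ M)
  [(grassmannianSheaf M k).obj.IsRepresentable]

/-- **THE UNIVERSAL SUBBUNDLE `𝒮 = ker(𝒪_{Gr} ⊗ M ↠ 𝒬)` HAS RANK `#J − k`.**
[cite: GortzWedhorn2020, (8.4) (pp. 213–215)] [cite: GortzWedhorn2023, (17.7) and Thm. 17.46 (pp. 22–23)] -/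
theorem hasRank_kernel_universalQuotientπ :
    HasRank (kernel (universalQuotientπ k M b)) (Fintype.card J - k) :=
  haveI := epi_universalQuotientπ k M b
  hasRank_kernel_of_epi_freeModule (universalQuotientπ k M b) (hasRank_universalQuotient k M b)

/-- The universal subbundle is finite locally free.
[cite: GortzWedhorn2023, (17.7) and Thm. 17.46 (pp. 22–23)] -/
theorem isFiniteLocallyFree_kernel_universalQuotientπ :
    IsFiniteLocallyFree (kernel (universalQuotientπ k M b)) :=
  HasRank.isFiniteLocallyFree' (hasRank_kernel_universalQuotientπ k M b)

/-- The universal subbundle is affine-localizing (its sections on affine opens localize).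
[cite: StacksProject, Tag 089R] -/
theorem isAffineLocalizing_kernel_universalQuotientπ :
    IsAffineLocalizing (kernel (universalQuotientπ k M b)) :=
  haveI := epi_universalQuotientπ k M b
  isAffineLocalizing_kernel_of_hasRank (universalQuotientπ k M b) (hasRank_freeModule _ J)
    (hasRank_universalQuotient k M b)

/-- **The universal quotient map `𝒪_{Gr}^{(J)} ⟶ 𝒬` is onto on the sections over every affine open**
(so `0 → Γ(V, 𝒮) → Γ(Gr, V) ⊗ M → Γ(𝒬, V) → 0` is exact for affine `V`).
[cite: GortzWedhorn2020, (8.4) (pp. 213–215)] [cite: StacksProject, Tag 089R] -/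
theorem app_universalQuotientπ_surjective {V : (grassmannianScheme M k).Opens} (hV : IsAffineOpen V) :
    Function.Surjective ((universalQuotientπ k M b).app V) :=
  haveI := epi_universalQuotientπ k M b
  app_surjective_of_epi_of_hasRank (universalQuotientπ k M b) (hasRank_freeModule _ J)
    (hasRank_universalQuotient k M b) hV

include b in
/-- If the Grassmannian scheme has a point then `k ≤ #J`. [cite: GortzWedhorn2020, (8.4) (pp. 213–215)] -/
theorem le_card_of_mem (t : grassmannianScheme M k) : k ≤ Fintype.card J :=
  haveI := epi_universalQuotientπ k M b
  le_card_of_epi_freeModule (universalQuotientπ k M b) (hasRank_universalQuotient k M b) t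

omit [Fintype J] in
/-- **The pulled-back tautological sequence**: along any `f : T ⟶ Gr`, `f^*π : f^*𝒪_{Gr}^{(J)} ⟶ f^*𝒬` is
an epimorphism (pull-back is a left adjoint). [cite: GortzWedhorn2023, (17.7) and Thm. 17.46 (pp. 22–23)] -/
theorem epi_map_pullback_universalQuotientπ {T : Scheme.{u}} (f : T ⟶ grassmannianScheme M k) :
    Epi ((Scheme.Modules.pullback f).map (universalQuotientπ k M b)) :=
  haveI := epi_universalQuotientπ k M b
  inferInstance

/-- **The kernel of the pulled-back universal quotient `f^*𝒪_{Gr}^{(J)} ↠ f^*𝒬` has rank `#J − k`** for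
every `f : T ⟶ Gr`. [cite: GortzWedhorn2023, (17.7) and Thm. 17.46 (pp. 22–23)] [cite: StacksProject, Tag 05P2] -/
theorem hasRank_kernel_map_pullback_universalQuotientπ {T : Scheme.{u}} (f : T ⟶ grassmannianScheme M k) :
    HasRank (kernel ((Scheme.Modules.pullback f).map (universalQuotientπ k M b))) (Fintype.card J - k) :=
  haveI := epi_map_pullback_universalQuotientπ k M b f
  hasRank_kernel_of_epi _ (hasRank_pullback f (hasRank_freeModule _ J))
    (hasRank_pullback f (hasRank_universalQuotient k M b))

end Literature.AlgebraicGeometry.Motives.Grassmannian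

end
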